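import Literature.Analysis.Complex.RungeUnits

/-!
# BalabanUVNodes ∕ node N18 = NE5 — closure-ledger item (iii), (β3) second brick: THE SECOND-ORDER REMAINDER OF THE EXPONENTIAL IS LIPSCHITZ WITH THE SMALLNESS
# FACTOR — `‖(e^X − 1 − X) − (e^Y − 1 − Y)‖ ≤ ‖X − Y‖·(e^r − 1)` for `‖X‖, ‖Y‖ ≤ r` in any complete normed `ℂ`-algebra, and its reading for bond variables
# `U_b = e^{iξA_b}`: `‖(U − 1 − iξA) − (U′ − 1 − iξA′)‖ ≤ ξ·‖A − A′‖·(e^{ξr} − 1)` (Track A, DAG node N18 = `T4OutputRate.NE5` :211; cluster K4 «SpineRates», item K3⁷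
# `SpineGivenEndpointR13SepCoPH`; module 27 of seat pub-ymgap-dag-n18-d, strategy s2)

HONEST FRAMING.  Count-neutral kernel bookkeeping (`--supports stmt-QuantumFields-20544 --as helper`); elementary, PROVED (the exponential series term by term, as
in `Literature.Analysis.Complex.norm_exp_sub_exp_le`, with the two lowest terms removed).  NE5 is NOT PRINTED and NOT proved; N18 is NOT discharged.

WHY.  (β3) of the seat's `N18-BETA-SPEC.md`: the (1.12) letters of a TRANSPORTED units field are read through the chart `A ↦ U = e^{iξA}`, `Ū ↦ Ā = (iξ)⁻¹ log Ū`;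
besides the averaging remainder (modules 22–26) the chart contributes two second-order remainders, `U − 1 − iξA` (this file) and `log Ū − (Ū − 1)` (IN THE TREE:
`BlockAveragingFederbush.norm_mlog_sub_mlog_sub_le`, `‖log A − log B − (A − B)‖ ≤ ρ∕(1−ρ)·‖A − B‖`), and the coarse-difference letter needs each of them LIPSCHITZ
with a constant that is SMALL with the ball (`e^r − 1 ≤ 2r` for `r ≤ 1`) — the plain Lipschitz bound of `exp` (`B9Eq373TransporterLipschitzLetters.norm_exp_sub_exp_le_of_norm_le`,
constant `e^r`) is not enough.

WHAT.  ★ `norm_expRem_sub_expRem_le` (`max`-form), `norm_expRem_sub_expRem_le_of_norm_le` (`r`-form), ★ `norm_expRem_smul_sub_le` (the `iξA` reading),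
`norm_expRem_smul_sub_le_linear` (the same with `e^{ξr} − 1 ≤ 2ξr` for `ξr ≤ 1`).

WHAT THIS IS NOT.  Not the (1.12) letters; not (β); finite tori — not continuum ∕ OS ∕ mass gap ∕ Clay.  0 `def`, 0 `sorry`, standard axioms.
-/

open NormedSpace
open scoped Nat

namespace YMDAG.N18.HolonomyLipschitz

open Literature.Analysis.Complex (norm_pow_succ_sub_pow_succ_le)

section Exp

variable {𝔄 : Type*} [NormedRing 𝔄] [NormedAlgebra ℂ 𝔄] [CompleteSpace 𝔄] [NormOneClass 𝔄]

/-- ★ **THE SECOND-ORDER REMAINDER OF `exp` IS LIPSCHITZ WITH THE SMALLNESS FACTOR**: `‖(e^x − 1 − x) − (e^y − 1 − y)‖ ≤ ‖x − y‖·(e^M − 1)`,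
`M = max(‖x‖, ‖y‖)`, in any complete normed `ℂ`-algebra (term by term: `‖xⁿ − yⁿ‖ ≤ n Mⁿ⁻¹‖x − y‖` summed over `n ≥ 2`). [folklore] -/
theorem norm_expRem_sub_expRem_le (x y : 𝔄) :
    ‖(exp x - 1 - x) - (exp y - 1 - y)‖ ≤ ‖x - y‖ * (Real.exp (max ‖x‖ ‖y‖) - 1) := by
  nontriviality 𝔄
  set M := max ‖x‖ ‖y‖ with hM
  -- the series of differences and its tail from `n = 2`
  set f : ℕ → 𝔄 := fun n => ((n ! : ℂ))⁻¹ • x ^ n - ((n ! : ℂ))⁻¹ • y ^ n with hf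
  have hsub : HasSum f (exp x - exp y) := by
    have h := (exp_series_hasSum_exp' (𝕂 := ℂ) x).sub (exp_series_hasSum_exp' (𝕂 := ℂ) y)
    simpa [hf] using h
  have h01 : ∑ i ∈ Finset.range 2, f i = x - y := by
    simp [hf, Finset.sum_range_succ]
  have htail : HasSum (fun n => f (n + 2)) ((exp x - exp y) - (x - y)) := by
    rw [← h01]; exact (hasSum_nat_add_iff' 2).2 hsub
  have e : (exp x - 1 - x) - (exp y - 1 - y) = (exp x - exp y) - (x - y) := by abel
  rw [e, ← htail.tsum_eq]
  -- the dominating real series `b n = M^{n+1}/(n+1)! · ‖x − y‖`, with sum `(e^M − 1)‖x − y‖`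
  set b : ℕ → ℝ := fun n => M ^ (n + 1) / (n + 1)! * ‖x - y‖ with hb
  have hreal : HasSum (fun n : ℕ => M ^ n / n !) (Real.exp M) := by
    have h := exp_series_hasSum_exp' (𝕂 := ℝ) M
    rw [← Real.exp_eq_exp_ℝ] at h
    simpa [smul_eq_mul, div_eq_inv_mul] using h
  have hreal1 : HasSum (fun n : ℕ => M ^ (n + 1) / (n + 1)!) (Real.exp M - 1) := by
    have h := (hasSum_nat_add_iff' 1).2 hreal
    simpa using h
  have hbsum : HasSum b (‖x - y‖ * (Real.exp M - 1)) := by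
    rw [mul_comm]
    simpa [hb] using hreal1.mul_right ‖x - y‖
  refine tsum_of_norm_bounded hbsum fun n => ?_
  simp only [hf, hb]
  rw [← smul_sub, norm_smul, norm_inv, Complex.norm_natCast]
  have hfac : ((n + 2)! : ℝ) = (n + 2) * (n + 1)! := by push_cast [Nat.factorial_succ]; ring
  have hm0 : (0 : ℝ) < (n + 1)! := by positivity
  have hpow := norm_pow_succ_sub_pow_succ_le x y (n + 1)
  rw [← hM] at hpow
  calc ((n + 2)! : ℝ)⁻¹ * ‖x ^ (n + 2) - y ^ (n + 2)‖ ≤ ((n + 2)! : ℝ)⁻¹ * ((n + 1 + 1) * M ^ (n + 1) * ‖x - y‖) :=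
        mul_le_mul_of_nonneg_left (by exact_mod_cast hpow) (by positivity)
    _ = M ^ (n + 1) / (n + 1)! * ‖x - y‖ := by
        rw [hfac]; field_simp; ring

/-- The same with a common bound `r` on `‖x‖, ‖y‖`: `‖(e^x − 1 − x) − (e^y − 1 − y)‖ ≤ ‖x − y‖·(e^r − 1)`. [folklore] -/
theorem norm_expRem_sub_expRem_le_of_norm_le {x y : 𝔄} {r : ℝ} (hx : ‖x‖ ≤ r) (hy : ‖y‖ ≤ r) :
    ‖(exp x - 1 - x) - (exp y - 1 - y)‖ ≤ ‖x - y‖ * (Real.exp r - 1) :=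
  (norm_expRem_sub_expRem_le x y).trans
    (mul_le_mul_of_nonneg_left (sub_le_sub_right (Real.exp_le_exp.2 (max_le hx hy)) 1) (norm_nonneg _))

omit [NormedRing 𝔄] [NormedAlgebra ℂ 𝔄] [CompleteSpace 𝔄] [NormOneClass 𝔄] in
/-- `e^r − 1 ≤ 2r` for `0 ≤ r ≤ 1` (the smallness factor is of order `r`; public twin in `Literature.NumberTheory.Sieve`, not imported; kept private). [folklore] -/
private theorem exp_sub_one_le_two_mul {r : ℝ} (hr0 : 0 ≤ r) (hr1 : r ≤ 1) : Real.exp r - 1 ≤ 2 * r := by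
  have h := Real.abs_exp_sub_one_le (x := r) (by rwa [abs_of_nonneg hr0])
  rw [abs_of_nonneg hr0] at h
  exact (le_abs_self _).trans h

/-- ★ **THE `iξA` READING**: for real `ξ ≥ 0` and `‖A‖, ‖A′‖ ≤ r`, `‖(e^{iξA} − 1 − iξA) − (e^{iξA′} − 1 − iξA′)‖ ≤ ξ·‖A − A′‖·(e^{ξr} − 1)` — the second-order
remainder of the bond-variable chart `A ↦ U = e^{iξA}` is Lipschitz in `A` with a constant `O(ξ²r)`. [cite: Balaban1987RG1, (1.18) p.263 (the chart `U = exp iηA`)] -/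
theorem norm_expRem_smul_sub_le {ξ : ℝ} (hξ : 0 ≤ ξ) {A A' : 𝔄} {r : ℝ} (hA : ‖A‖ ≤ r) (hA' : ‖A'‖ ≤ r) :
    ‖(exp ((Complex.I * ξ : ℂ) • A) - 1 - (Complex.I * ξ : ℂ) • A) - (exp ((Complex.I * ξ : ℂ) • A') - 1 - (Complex.I * ξ : ℂ) • A')‖ ≤
      ξ * ‖A - A'‖ * (Real.exp (ξ * r) - 1) := by
  have hn : ‖(Complex.I * ξ : ℂ)‖ = ξ := by rw [norm_mul, Complex.norm_I, one_mul, Complex.norm_real, Real.norm_of_nonneg hξ]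
  have h1 : ‖(Complex.I * ξ : ℂ) • A‖ ≤ ξ * r := by rw [norm_smul, hn]; exact mul_le_mul_of_nonneg_left hA hξ
  have h2 : ‖(Complex.I * ξ : ℂ) • A'‖ ≤ ξ * r := by rw [norm_smul, hn]; exact mul_le_mul_of_nonneg_left hA' hξ
  have h := norm_expRem_sub_expRem_le_of_norm_le h1 h2
  rw [← smul_sub, norm_smul, hn] at h
  exact h

/-- The `iξA` reading with a LINEAR constant: for `ξr ≤ 1`, `‖(e^{iξA} − 1 − iξA) − (e^{iξA′} − 1 − iξA′)‖ ≤ 2ξ²r·‖A − A′‖`.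
[cite: Balaban1987RG1, (1.18) p.263 (the chart `U = exp iηA`)] -/
theorem norm_expRem_smul_sub_le_linear {ξ : ℝ} (hξ : 0 ≤ ξ) {A A' : 𝔄} {r : ℝ} (hr : 0 ≤ r) (hξr : ξ * r ≤ 1) (hA : ‖A‖ ≤ r) (hA' : ‖A'‖ ≤ r) :
    ‖(exp ((Complex.I * ξ : ℂ) • A) - 1 - (Complex.I * ξ : ℂ) • A) - (exp ((Complex.I * ξ : ℂ) • A') - 1 - (Complex.I * ξ : ℂ) • A')‖ ≤
      2 * ξ ^ 2 * r * ‖A - A'‖ := by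
  have h := norm_expRem_smul_sub_le hξ hA hA'
  have h2 : Real.exp (ξ * r) - 1 ≤ 2 * (ξ * r) := exp_sub_one_le_two_mul (mul_nonneg hξ hr) hξr
  have h3 : ξ * ‖A - A'‖ * (Real.exp (ξ * r) - 1) ≤ ξ * ‖A - A'‖ * (2 * (ξ * r)) :=
    mul_le_mul_of_nonneg_left h2 (mul_nonneg hξ (norm_nonneg _))
  calc _ ≤ ξ * ‖A - A'‖ * (2 * (ξ * r)) := h.trans h3
    _ = 2 * ξ ^ 2 * r * ‖A - A'‖ := by ring

end Exp

end YMDAG.N18.HolonomyLipschitz
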